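import Summits.BirchSwinnertonDyer.BirchSwinnertonDyer.Theorems.ManinLocalTwoThreeKummerDiamondShapeAlgebra
import Literature.NumberTheory.EllipticCurves.TwoDescent
import Literature.NumberTheory.EllipticCurves.KramerDescentSelmerTwoSpanProofs
import HarnessLib

/-!
# E-es-185 STEP 3 (MEMO-es §59.5 / §59.13(b)) IN THE TREE'S SQUARE-CLASS LANGUAGE: the four-case descent table
# for the Legendre curve `y² = x(x − A)(x − B)` forces the Frey-twist shape
(route `ManinLocalTwoThree`, crux C2 `ManinOddAtFour` stmt-BirchSwinnertonDyer-22967; cell bsd-f2-manin, C2/C3 LEAD p1 gen 19;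
`--supports stmt-BirchSwinnertonDyer-22967`; line card `Lines/kummer_diamond.md` item D7; builds on D8 = p758887
`…KummerDiamondShapeAlgebra` and is meant to be fed by p2's Legendre normal form p758643 and, eventually, THEOREM K + STEP 2)

In the index-4 world, after STEP 1–2 of es g38's EXCLUSION THEOREM, the 2-descent classes of the rational 2-torsion points
`T₁ = (0,0)`, `T₂ = (A,0)` of the Legendre model `y² = x(x − A)(x − B)` of `W₀` lie in `{h₁, h₂}` with `h₁ = (2, d, ·)`,
`h₂ = (1, −p, −p)`, `p ≡ 3 (mod 4)` prime (THEOREM K + LEMMA M + signs).  In the coordinates of the tree's complete 2-descent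
(`WeierstrassCurve.Affine.twoDescentComponent`: `T₁ ↦ ((e₁−e₂)(e₁−e₃), e₁−e₂)`, `T₂ ↦ (e₂−e₁, (e₂−e₁)(e₂−e₃))` with
`(e₁,e₂,e₃) = (0, A, B)`) these classes are `(sqClass (AB), sqClass (−A))` and `(sqClass A, sqClass (A(A−B)))`.  This file proves,
with NO elliptic-curve input:

* `legendre_descent_cases` — the four cases (i) `(h₂,h₁)`, (ii) `(h₁,h₂)`, (iii-h₁) `(h₁,h₁)`, (iii-h₂) `(h₂,h₂)` of §59.5 STEP 3:
  (i) and (iii-h₂) are impossible (`p ≡ 2`, resp. `p ≡ 1`, modulo squares — `v_p` parity), (ii) gives `A = (μt)²`, `B = 2(μs)²`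
  via a 2-primitive `u² + p·w² = 2m²` (so `t` odd, `s` even, and `p ≡ 7 (mod 8)`), (iii-h₁) gives `A = 2(μs)²`, `B = (μt)²` via
  `b² = 2a² + c²`; the second coordinate `d` of `h₁` is NOT needed (only that `T₁`, `T₂` share it in case (iii-h₁)).
* `hasFreyTwistShape_of_legendre_descent_cases` — hence any `W/ℚ` with `C • W = ⟨0, −(A+B), 0, AB, 0⟩` and such classes has
  `KummerDiamond.HasFreyTwistShape W` (D8's `hasFreyTwistShape_of_twoTorsion_differences` + composition of variable changes).

HONEST FRAMING: SUPPORT lemmas (elementary number theory); THEOREM K (Stevens 1982 Thm. 1.3.1(b)), Manin–Drinfeld at `w_Q∞`, and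
STEP 2 are NOT here; nothing about C2, Manin's conjecture or BSD is proved; C2/C3 OPEN as filed.
-/

set_option autoImplicit false
-- lint-debt: the directory name repeats the summit name (sibling precedent `ManinLocalTwoThreeKummerDiamondShapeAlgebra.lean`)
set_option linter.dupNamespace false

noncomputable section

open WeierstrassCurve WeierstrassCurve.Affine
open Literature.NumberTheory.EllipticCurves.KramerTwoDescent (exists_eq_mul_sq_of_sqClass_eq)
open Summit.BirchSwinnertonDyer.Rank1Residual.ManinAdditive.KummerDiamond
open Summit.BirchSwinnertonDyer.BirchSwinnertonDyer.Theorems.ManinLocalTwoThree.KummerDiamondShape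

namespace Summit.BirchSwinnertonDyer.BirchSwinnertonDyer.Theorems.ManinLocalTwoThree.KummerDiamondCases

/-! ## §1 `v_p`-parity: a prime is neither a square nor twice a square in `ℚ` -/

/-- `u² = p·r²` with `u ≠ 0` is impossible for a prime `p` (`v_p` is even on the left, odd on the right). [folklore] -/
theorem sq_ne_prime_mul_sq {p : ℕ} (hp : p.Prime) {u r : ℚ} (hu : u ≠ 0) : u ^ 2 ≠ (p : ℚ) * r ^ 2 := by
  intro h
  haveI : Fact p.Prime := ⟨hp⟩
  have hr : r ≠ 0 := by
    rintro rfl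
    exact pow_ne_zero 2 hu (by rw [h]; ring)
  have hpQ : (p : ℚ) ≠ 0 := by exact_mod_cast hp.ne_zero
  have hv := congrArg (padicValRat p) h
  rw [padicValRat.pow, padicValRat.mul hpQ (pow_ne_zero 2 hr), padicValRat.pow, padicValRat.self hp.one_lt] at hv
  omega

/-- `p·r² = 2·a²` with `a ≠ 0` is impossible for an odd prime `p` (`v_p` parity again; `v_p(2) = 0`). [folklore] -/
theorem prime_mul_sq_ne_two_mul_sq {p : ℕ} (hp : p.Prime) (hp2 : p ≠ 2) {r a : ℚ} (ha : a ≠ 0) :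
    (p : ℚ) * r ^ 2 ≠ 2 * a ^ 2 := by
  intro h
  haveI : Fact p.Prime := ⟨hp⟩
  have hpQ : (p : ℚ) ≠ 0 := by exact_mod_cast hp.ne_zero
  have hr : r ≠ 0 := by
    rintro rfl
    have : (2 : ℚ) * a ^ 2 = 0 := by rw [← h]; ring
    exact (mul_ne_zero two_ne_zero (pow_ne_zero 2 ha)) this
  have h2 : padicValRat p (2 : ℚ) = 0 := by
    rw [show (2 : ℚ) = ((2 : ℕ) : ℚ) by norm_num, padicValRat.of_nat, Nat.cast_eq_zero]
    exact padicValNat.eq_zero_of_not_dvd fun hdvd => hp2 ((Nat.prime_dvd_prime_iff_eq hp Nat.prime_two).mp hdvd)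
  have hv := congrArg (padicValRat p) h
  rw [padicValRat.mul hpQ (pow_ne_zero 2 hr), padicValRat.pow, padicValRat.self hp.one_lt,
    padicValRat.mul two_ne_zero (pow_ne_zero 2 ha), padicValRat.pow, h2] at hv
  omega

/-! ## §2 The four-case table -/

/-- **E-es-185 STEP 3, cases (i)–(iii) (§59.5 / §59.13(b)), `E`-free.**  Let `A, B ∈ ℚˣ`, `A ≠ B` (the Legendre curve
`y² = x(x − A)(x − B)`), `p ≡ 3 (mod 4)` prime, `δ ∈ ℚˣ/ℚˣ²` arbitrary (the second coordinate of `h₁`).  If the descent classes of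
`T₁ = (0,0)` and `T₂ = (A,0)` — `(sqClass (AB), sqClass (−A))` and `(sqClass A, sqClass (A(A−B)))` — each equal `h₁ = (sqClass 2, δ)`
or `h₂ = (1, sqClass (−p))`, then `(A, B) = ((μt)², 2(μs)²)` or `(2(μs)², (μt)²)` with `μ ≠ 0`, `s` even, `t` odd.
[cite: Stevens1989, §2] [cite: SilvermanAEC2009, Prop. X.1.4] -/
theorem legendre_descent_cases {A B : ℚ} (hA : A ≠ 0) (hB : B ≠ 0) (hAB : A ≠ B) {p : ℕ} (hp : p.Prime) (hp4 : p % 4 = 3)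
    (δ : SqUnits ℚ)
    (hT₁ : (sqClass (A * B) = sqClass (2 : ℚ) ∧ sqClass (-A) = δ) ∨
      (sqClass (A * B) = 1 ∧ sqClass (-A) = sqClass (-(p : ℚ))))
    (hT₂ : (sqClass A = sqClass (2 : ℚ) ∧ sqClass (A * (A - B)) = δ) ∨
      (sqClass A = 1 ∧ sqClass (A * (A - B)) = sqClass (-(p : ℚ)))) :
    ∃ (μ : ℚ) (s t : ℤ), μ ≠ 0 ∧ Even s ∧ Odd t ∧
      ((A = (μ * t) ^ 2 ∧ B = 2 * (μ * s) ^ 2) ∨ (A = 2 * (μ * s) ^ 2 ∧ B = (μ * t) ^ 2)) := by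
  have hp2 : p ≠ 2 := by rintro rfl; norm_num at hp4
  have hpZ : (p : ℤ) % 4 = 3 := by omega
  have hpQ : (p : ℚ) ≠ 0 := by exact_mod_cast hp.ne_zero
  have hnegp : (-(p : ℚ)) ≠ 0 := neg_ne_zero.mpr hpQ
  have hAmB : A - B ≠ 0 := sub_ne_zero.mpr hAB
  have hnegA : -A ≠ 0 := neg_ne_zero.mpr hA
  rcases hT₂ with ⟨hA2, hAAB⟩ | ⟨hA1, hAAB⟩
  · -- `A ≡ 2`: `A = 2a₀²`
    obtain ⟨a₀, hAa⟩ := exists_eq_mul_sq_of_sqClass_eq hA two_ne_zero hA2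
    have ha₀ : a₀ ≠ 0 := by rintro rfl; exact hA (by rw [hAa]; ring)
    rcases hT₁ with ⟨hAB2, hnegAδ⟩ | ⟨-, hnegAp⟩
    · -- case (iii-h₁): `B ≡ 1`, `A − B ≡ −1`
      have hB1 : sqClass B = 1 := by
        have h := hAB2
        rw [sqClass_mul hA hB, hA2] at h
        -- `[2][B] = [2]` ⟹ `[B] = 1`
        have := congrArg (HMul.hMul (sqClass (2 : ℚ))) h
        rwa [← mul_assoc, SqUnits.mul_self, SqUnits.one_mul] at this
      obtain ⟨b₀, hBb⟩ := (sqClass_eq_one_iff hB).mp hB1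
      have hb₀ : b₀ ≠ 0 := by rintro rfl; exact hB (by rw [hBb]; ring)
      -- `[A(A−B)] = δ = [−A]` ⟹ `[A−B] = [−1]`
      have hcls : sqClass (A - B) = sqClass (-1 : ℚ) := by
        have h : sqClass (A * (A - B)) = sqClass (-A) := by rw [hAAB, hnegAδ]
        rw [sqClass_mul hA hAmB, show -A = (-1) * A by ring, sqClass_mul (by norm_num) hA] at h
        have := congrArg (HMul.hMul (sqClass A)) h
        rwa [← mul_assoc, SqUnits.mul_self, SqUnits.one_mul, SqUnits.mul_comm (sqClass (-1 : ℚ)) (sqClass A),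
          ← mul_assoc, SqUnits.mul_self, SqUnits.one_mul] at this
      obtain ⟨c₀, hABc⟩ := exists_eq_mul_sq_of_sqClass_eq hAmB (by norm_num) hcls
      -- `b₀² = 2a₀² + c₀²`; scale to a 2-primitive integer triple
      have hrel : b₀ ^ 2 = 2 * a₀ ^ 2 + c₀ ^ 2 := by linear_combination -hBb + hAa - hABc
      obtain ⟨μ, a, b, c, hμ, ha, hb, hc, hprim⟩ :=
        exists_two_primitive_scaling a₀ b₀ c₀ (fun h => ha₀ h.1)
      have hrelZ : (b : ℤ) ^ 2 = 2 * a ^ 2 + c ^ 2 := by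
        have h : (μ ^ 2) * ((b : ℚ) ^ 2 - (2 * a ^ 2 + c ^ 2)) = 0 := by
          rw [ha, hb, hc] at hrel; linear_combination hrel
        have h' : ((b : ℚ) ^ 2 - (2 * a ^ 2 + c ^ 2)) = 0 := by
          exact (mul_eq_zero.mp h).resolve_left (pow_ne_zero 2 hμ)
        exact_mod_cast (sub_eq_zero.mp h')
      obtain ⟨hae, hbo, -⟩ := parity_of_sq_eq_two_mul_sq_add_sq hrelZ hprim
      refine ⟨μ, a, b, hμ, hae, hbo, Or.inr ⟨?_, ?_⟩⟩
      · rw [hAa, ha]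
      · rw [hBb, hb]
    · -- case (i): `A ≡ 2` and `−A ≡ −p` ⟹ `p ≡ 2` — impossible
      exfalso
      have hcls : sqClass A = sqClass (p : ℚ) := by
        have h := hnegAp
        rw [show -A = (-1) * A by ring, show -(p : ℚ) = (-1) * p by ring, sqClass_mul (by norm_num) hA,
          sqClass_mul (by norm_num) hpQ] at h
        have := congrArg (HMul.hMul (sqClass (-1 : ℚ))) h
        rwa [← mul_assoc, SqUnits.mul_self, SqUnits.one_mul, ← mul_assoc, SqUnits.mul_self, SqUnits.one_mul] at this
      obtain ⟨r, hAr⟩ := exists_eq_mul_sq_of_sqClass_eq hA hpQ hcls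
      exact prime_mul_sq_ne_two_mul_sq hp hp2 (r := r) ha₀ (by rw [← hAr, hAa])
  · -- `A ≡ 1`: `A = u₀²`, and `A − B ≡ −p`
    obtain ⟨u₀, hAu⟩ := (sqClass_eq_one_iff hA).mp hA1
    have hu₀ : u₀ ≠ 0 := by rintro rfl; exact hA (by rw [hAu]; ring)
    have hcls : sqClass (A - B) = sqClass (-(p : ℚ)) := by
      rw [sqClass_mul hA hAmB, hA1, SqUnits.one_mul] at hAAB; exact hAAB
    obtain ⟨w₀, hABw⟩ := exists_eq_mul_sq_of_sqClass_eq hAmB hnegp hcls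
    rcases hT₁ with ⟨hAB2, -⟩ | ⟨-, hnegAp⟩
    · -- case (ii): `AB ≡ 2` ⟹ `B ≡ 2`
      have hB2 : sqClass B = sqClass (2 : ℚ) := by
        rw [sqClass_mul hA hB, hA1, SqUnits.one_mul] at hAB2; exact hAB2
      obtain ⟨m₀, hBm⟩ := exists_eq_mul_sq_of_sqClass_eq hB two_ne_zero hB2
      -- `u₀² + p w₀² = 2 m₀²`
      have hrel : u₀ ^ 2 + p * w₀ ^ 2 = 2 * m₀ ^ 2 := by linear_combination -hAu + hABw + hBm
      obtain ⟨μ, u, w, m, hμ, hu, hw, hm, hprim⟩ :=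
        exists_two_primitive_scaling u₀ w₀ m₀ (fun h => hu₀ h.1)
      have hrelZ : (u : ℤ) ^ 2 + p * w ^ 2 = 2 * m ^ 2 := by
        have h : (μ ^ 2) * ((u : ℚ) ^ 2 + p * w ^ 2 - 2 * m ^ 2) = 0 := by
          rw [hu, hw, hm] at hrel; linear_combination hrel
        have h' : ((u : ℚ) ^ 2 + p * w ^ 2 - 2 * m ^ 2) = 0 :=
          (mul_eq_zero.mp h).resolve_left (pow_ne_zero 2 hμ)
        have h'' : ((u : ℚ) ^ 2 + p * w ^ 2) = 2 * m ^ 2 := sub_eq_zero.mp h'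
        exact_mod_cast h''
      obtain ⟨huo, -, hme, -⟩ := parity_of_sq_add_mul_sq_eq_two_mul_sq hpZ hrelZ hprim
      refine ⟨μ, m, u, hμ, hme, huo, Or.inl ⟨?_, ?_⟩⟩
      · rw [hAu, hu]
      · rw [hBm, hm]
    · -- case (iii-h₂): `A ≡ 1` and `−A ≡ −p` ⟹ `p ≡ 1` — impossible
      exfalso
      have hcls' : sqClass A = sqClass (p : ℚ) := by
        have h := hnegAp
        rw [show -A = (-1) * A by ring, show -(p : ℚ) = (-1) * p by ring, sqClass_mul (by norm_num) hA,
          sqClass_mul (by norm_num) hpQ] at h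
        have := congrArg (HMul.hMul (sqClass (-1 : ℚ))) h
        rwa [← mul_assoc, SqUnits.mul_self, SqUnits.one_mul, ← mul_assoc, SqUnits.mul_self, SqUnits.one_mul] at this
      obtain ⟨r, hAr⟩ := exists_eq_mul_sq_of_sqClass_eq hA hpQ hcls'
      exact sq_ne_prime_mul_sq hp hu₀ (r := r) (by rw [← hAu, hAr])

/-! ## §3 From the Legendre model to the Frey-twist shape -/

/-- **E-es-185 STEP 3, conclusion.**  If some change of variables carries `W/ℚ` to the Legendre model
`⟨0, −(A+B), 0, AB, 0⟩` (`y² = x(x − A)(x − B)`; p2 p758643 `TwoTorsionNormalForm.exists_variableChange_eq_legendre`) and the descent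
classes of `T₁, T₂` satisfy the four-case hypothesis of `legendre_descent_cases`, then `W` has the Frey-twist shape
`y² = x(x − 2s²)(x − t²)`, `s` even, `t` odd: `KummerDiamond.HasFreyTwistShape W`. [cite: Stevens1989, §2] [cite: SilvermanAEC2009, Prop. X.1.4] -/
theorem hasFreyTwistShape_of_legendre_descent_cases (W : WeierstrassCurve ℚ) {C : VariableChange ℚ} {A B : ℚ}
    (hC : C • W = ⟨0, -(A + B), 0, A * B, 0⟩) (hA : A ≠ 0) (hB : B ≠ 0) (hAB : A ≠ B) {p : ℕ} (hp : p.Prime)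
    (hp4 : p % 4 = 3) (δ : SqUnits ℚ)
    (hT₁ : (sqClass (A * B) = sqClass (2 : ℚ) ∧ sqClass (-A) = δ) ∨
      (sqClass (A * B) = 1 ∧ sqClass (-A) = sqClass (-(p : ℚ))))
    (hT₂ : (sqClass A = sqClass (2 : ℚ) ∧ sqClass (A * (A - B)) = δ) ∨
      (sqClass A = 1 ∧ sqClass (A * (A - B)) = sqClass (-(p : ℚ)))) :
    HasFreyTwistShape W := by
  obtain ⟨μ, s, t, hμ, hs, ht, hcase⟩ := legendre_descent_cases hA hB hAB hp hp4 δ hT₁ hT₂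
  -- the Legendre model has `a₁ = a₃ = 0` and split 2-division cubic with roots `0, A, B`
  have h₁ : (C • W).a₁ = 0 := by rw [hC]
  have h₃ : (C • W).a₃ = 0 := by rw [hC]
  have hsplit : ∀ x : ℚ, x ^ 3 + (C • W).a₂ * x ^ 2 + (C • W).a₄ * x + (C • W).a₆ = (x - 0) * (x - A) * (x - B) := by
    intro x; rw [hC]; ring
  have hshape : HasFreyTwistShape (C • W) := by
    rcases hcase with ⟨hAt, hBs⟩ | ⟨hAs, hBt⟩
    · exact hasFreyTwistShape_of_twoTorsion_differences' (C • W) h₁ h₃ hsplit hμ hs ht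
        (by rw [sub_zero, hAt]) (by rw [sub_zero, hBs])
    · exact hasFreyTwistShape_of_twoTorsion_differences (C • W) h₁ h₃ hsplit hμ hs ht
        (by rw [sub_zero, hAs]) (by rw [sub_zero, hBt])
  obtain ⟨s', t', C', hs', ht', hC'⟩ := hshape
  exact ⟨s', t', C' * C, hs', ht', by rw [mul_smul, hC']⟩

end Summit.BirchSwinnertonDyer.BirchSwinnertonDyer.Theorems.ManinLocalTwoThree.KummerDiamondCases

end
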